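import Mathlib
import HarnessLib
import Literature.Analysis.FluidPDE.SteadyStrainedNS   -- IsSteadyClassicalNS (convect, frobeniusNormSq)
import Literature.Analysis.FluidPDE.SteadyNSSolution   -- IsSteadyNSSolution.rescale / .smul
import Literature.Analysis.FluidPDE.NSViscosityRescaling   -- frobeniusNormSq_const_smul
import Summits.AnomalousDissipation.AnomalousDissipation.Theorems.PointSinkConeDesingularisationStubDissipationPosOfFarField

/-!
# Stub `stub_blowdownCovariance` of the line `Sketch`
# (crux stmt-AnomalousDissipation-19034, `PointSink.ConeDesingularisation`)

THE BLOW-DOWN COVARIANCE DICTIONARY. Let `(Q, Pr)` be a smooth steady solution of the UNFORCED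
unit-viscosity Navier–Stokes system on `ℝ³`, let `λ > 1`, `k : ℕ`, `μ := λ^k`, and let `V` be
discretely self-similar of degree `-2/3` (`V (λ • x) = λ^{-2/3} • V x` off the origin). Put
`u_k y := μ^{2/3} Q (μ y)`, `p_k y := μ^{4/3} Pr (μ y)`. Then

1. `(u_k, p_k)` is a smooth steady solution of the unforced system with viscosity `ν_k = μ^{-1/3}`
   (`blowdown_rescale`: the Navier–Stokes scaling `Q ↦ μ Q(μ ·)`, `Pr ↦ μ² Pr(μ ·)` at fixed
   viscosity, the tree's `IsSteadyNSSolution.rescale`, composed with the viscosity normalisation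
   `(ν, u, p) ↦ (κν, κu, κ²p)`, the tree's `IsSteadyNSSolution.smul`, at `κ = μ^{-1/3}`:
   `κ μ = μ^{2/3}`, `κ² μ² = μ^{4/3}`);
2. the normalised `k`-th shell error of `Q` is the fundamental-shell error of `u_k`:
   `μ^{-5/3} ∫_{μ<|x|<λμ} ‖Q - V‖² = ∫_{1<|y|<λ} ‖u_k - V‖²` (`blowdown_shell_error`: change of
   variables `x = μ y`, `dx = μ³ dy`, and the iterated DSS law `V y = μ^{2/3} V(μ y)` on the shell);
3. the dissipation is `ν`-independent after the zeroth-law normalisation: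
   `ν_k ∫_{B_1} |∇u_k|² = ∫_{B_μ} |∇Q|²` (`blowdown_dissipation`: `∇u_k (y) = μ^{5/3} ∇Q(μ y)`,
   `|∇u_k|² = μ^{10/3} |∇Q(μ y)|²`, `dy = μ^{-3} dx`, `μ^{-1/3 + 10/3 - 3} = 1`).

References: elementary (chain rule; dilation of Lebesgue measure, Mathlib
`MeasureTheory.Measure.setIntegral_comp_smul_of_pos`); the scaling symmetries of the steady system
are the tree's `Literature.Analysis.FluidPDE.IsSteadyNSSolution.rescale/.smul`
(`SteadyNSSolution.lean`). The shell bookkeeping `λ^k • shell₀ = shell_k` and the iterated DSS law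
are reused from the sibling stub file (`coneDissip_smul_shell`, `coneDissip_dss_pow`,
`coneDissip_rpow_aux1`). The skeleton: `Lines/Sketch.lean` of the crux (TOOLS stub).
-/

noncomputable section

-- `Summit.<Summit>.<Problem>`: single-conjunct summit, the duplicate namespace is mandated (CONVENTIONS §2).
set_option linter.dupNamespace false

namespace Summit.AnomalousDissipation.AnomalousDissipation.Theorems

open MeasureTheory Filter Topology Set
open scoped Pointwise Laplacian ContDiff
open Literature.Analysis.FluidPDE

/-- Points / velocity values of `ℝ³`. -/
local notation "E³" => EuclideanSpace ℝ (Fin 3)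

/-! ## Exponent bookkeeping (`c > 0`) -/

/-- `c^{-1/3} c = c^{2/3}`. [folklore] -/
theorem blowdown_rpow_vel {c : ℝ} (hc : 0 < c) : c ^ (-(1 / 3 : ℝ)) * c = c ^ (2 / 3 : ℝ) := by
  rw [← Real.rpow_add_one hc.ne']
  norm_num

/-- `(c^{2/3})² = c^{4/3}`. [folklore] -/
theorem blowdown_rpow_sq {c : ℝ} (hc : 0 < c) : (c ^ (2 / 3 : ℝ)) ^ 2 = c ^ (4 / 3 : ℝ) := by
  rw [← Real.rpow_natCast _ 2, ← Real.rpow_mul hc.le]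
  norm_num

/-- `(c^{-1/3})² c² = c^{4/3}`. [folklore] -/
theorem blowdown_rpow_pres {c : ℝ} (hc : 0 < c) :
    (c ^ (-(1 / 3 : ℝ))) ^ 2 * c ^ 2 = c ^ (4 / 3 : ℝ) := by
  rw [← mul_pow, blowdown_rpow_vel hc, blowdown_rpow_sq hc]

/-- `c^{-1/3} (c^{2/3} c)² = c³`. [folklore] -/
theorem blowdown_rpow_dissip {c : ℝ} (hc : 0 < c) :
    c ^ (-(1 / 3 : ℝ)) * (c ^ (2 / 3 : ℝ) * c) ^ 2 = c ^ 3 := by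
  rw [← Real.rpow_add_one hc.ne', ← Real.rpow_natCast _ 2, ← Real.rpow_mul hc.le,
    ← Real.rpow_add hc, ← Real.rpow_natCast c 3]
  norm_num

/-! ## The two notions of steady classical solution -/

/-- A steady classical (`C^∞`) solution in the sense of `IsSteadyClassicalNS`
(`(u·∇)u = νΔu − ∇p + f`) is a steady solution in the `C²/C¹` sense of `IsSteadyNSSolution`
(`−νΔu + (u·∇)u + ∇p = f`). [folklore] -/
theorem blowdown_isSteadyNSSolution {ν : ℝ} {f u : E³ → E³} {p : E³ → ℝ}
    (h : IsSteadyClassicalNS ν f u p) : IsSteadyNSSolution ν f u p where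
  contDiff_velocity := contDiff_infty.1 h.smooth_velocity 2
  contDiff_pressure := contDiff_infty.1 h.smooth_pressure 1
  momentum y := by
    rw [h.momentum y]
    abel
  divFree := h.divFree

/-- Conversely, a steady solution in the sense of `IsSteadyNSSolution` with `C^∞` velocity and
pressure is a steady classical solution in the sense of `IsSteadyClassicalNS`. [folklore] -/
theorem blowdown_isSteadyClassicalNS {ν : ℝ} {f u : E³ → E³} {p : E³ → ℝ}
    (h : IsSteadyNSSolution ν f u p) (hu : ContDiff ℝ ∞ u) (hp : ContDiff ℝ ∞ p) :
    IsSteadyClassicalNS ν f u p where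
  smooth_velocity := hu
  smooth_pressure := hp
  momentum x := by
    rw [← h.momentum x]
    abel
  divFree := h.divFree

/-! ## Conjunct 1: the exact Navier–Stokes covariance -/

/-- **Exact NS covariance (blow-down).** If `(u, p)` is a smooth steady solution of the unforced
unit-viscosity Navier–Stokes system, then for all `c κ : ℝ` the pair `y ↦ (κ c) • u (c • y)`,
`y ↦ (κ² c²) p (c • y)` is a smooth steady solution of the unforced system with viscosity `κ`:
the Navier–Stokes scaling `u ↦ c u(c ·)`, `p ↦ c² p(c ·)` at fixed viscosity
(`IsSteadyNSSolution.rescale`) followed by the viscosity normalisation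
`(ν, u, p) ↦ (κν, κu, κ²p)` (`IsSteadyNSSolution.smul`); the zero force stays zero. [folklore] -/
theorem blowdown_rescale {u : E³ → E³} {p : E³ → ℝ} (h : IsSteadyClassicalNS 1 0 u p) (c κ : ℝ) :
    IsSteadyClassicalNS κ 0 (fun y => (κ * c) • u (c • y))
      (fun y => (κ ^ 2 * c ^ 2) * p (c • y)) := by
  have h1 := ((blowdown_isSteadyNSSolution h).rescale c).smul κ
  have h2 : IsSteadyNSSolution κ 0 (fun y => (κ * c) • u (c • y))
      (fun y => (κ ^ 2 * c ^ 2) * p (c • y)) := by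
    convert h1 using 1
    · rw [mul_one]
    · funext y
      simp
    · funext y
      simp [smul_smul]
    · funext y
      simp [mul_assoc]
  refine blowdown_isSteadyClassicalNS h2 ?_ ?_
  · exact (h.smooth_velocity.comp (contDiff_const_smul c)).const_smul (κ * c)
  · exact contDiff_const.mul (h.smooth_pressure.comp (contDiff_const_smul c))

/-! ## Conjunct 2: the shell error under the blow-down -/

/-- **Shell covariance of the far-field error.** For `λ > 0`, `k : ℕ` and a DSS field `V` of
degree `-2/3`, the normalised `k`-th shell error of `Q` equals the fundamental-shell error of
the blow-down `y ↦ (λ^k)^{2/3} Q (λ^k y)`: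
`(λ^k)^{-5/3} ∫_{λ^k<|x|<λ^{k+1}} ‖Q - V‖² = ∫_{1<|y|<λ} ‖(λ^k)^{2/3} Q(λ^k y) - V y‖²`
(change of variables `x = λ^k y`, `dx = λ^{3k} dy`, `λ^k • shell₀ = shell_k`, and
`V y = (λ^k)^{2/3} V(λ^k y)` on the shell). [folklore] -/
theorem blowdown_shell_error {lam : ℝ} {Q V : E³ → E³} (hlam : 0 < lam)
    (hV : ∀ x : E³, x ≠ 0 → V (lam • x) = lam ^ (-(2 / 3 : ℝ)) • V x) (k : ℕ) :
    (lam ^ k) ^ (-(5 / 3 : ℝ)) *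
        (∫ x in {x : E³ | lam ^ k < ‖x‖ ∧ ‖x‖ < lam ^ (k + 1)}, ‖Q x - V x‖ ^ 2) =
      ∫ y in {y : E³ | 1 < ‖y‖ ∧ ‖y‖ < lam},
        ‖(lam ^ k) ^ (2 / 3 : ℝ) • Q (lam ^ k • y) - V y‖ ^ 2 := by
  have hR : 0 < lam ^ k := pow_pos hlam k
  have h := Measure.setIntegral_comp_smul_of_pos volume (fun x => ‖Q x - V x‖ ^ 2)
    {x : E³ | 1 < ‖x‖ ∧ ‖x‖ < lam} hR
  rw [coneDissip_smul_shell hlam k, finrank_euclideanSpace_fin, smul_eq_mul,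
    eq_inv_mul_iff_mul_eq₀ (pow_ne_zero 3 hR.ne')] at h
  have hcongr : ∫ y in {y : E³ | 1 < ‖y‖ ∧ ‖y‖ < lam},
        ‖(lam ^ k) ^ (2 / 3 : ℝ) • Q (lam ^ k • y) - V y‖ ^ 2 =
      ∫ y in {y : E³ | 1 < ‖y‖ ∧ ‖y‖ < lam},
        (lam ^ k) ^ (4 / 3 : ℝ) * ‖Q (lam ^ k • y) - V (lam ^ k • y)‖ ^ 2 := by
    refine setIntegral_congr_fun (coneDissip_isOpen_shell lam).measurableSet fun y hy => ?_
    have hy0 : y ≠ 0 := norm_pos_iff.1 (one_pos.trans hy.1)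
    have hfac : (lam ^ k) ^ (2 / 3 : ℝ) • Q (lam ^ k • y) - V y =
        (lam ^ k) ^ (2 / 3 : ℝ) • (Q (lam ^ k • y) - (lam ^ k) ^ (-(2 / 3 : ℝ)) • V y) := by
      rw [smul_sub, smul_smul, ← Real.rpow_add hR]
      norm_num
    show ‖(lam ^ k) ^ (2 / 3 : ℝ) • Q (lam ^ k • y) - V y‖ ^ 2 =
      (lam ^ k) ^ (4 / 3 : ℝ) * ‖Q (lam ^ k • y) - V (lam ^ k • y)‖ ^ 2
    rw [coneDissip_dss_pow hlam hV k y hy0, hfac, norm_smul, mul_pow,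
      Real.norm_of_nonneg (Real.rpow_nonneg hR.le _), blowdown_rpow_sq hR]
  rw [hcongr, integral_const_mul, ← h, ← mul_assoc, coneDissip_rpow_aux1 hR]

/-! ## Conjunct 3: the dissipation under the blow-down -/

/-- Chain rule for the blow-down: `D(z ↦ a • Q (c • z))(y) = (a c) • DQ(c y)` for `Q`
differentiable (Mathlib's `fderiv_comp_smul`). [folklore] -/
theorem blowdown_fderiv {Q : E³ → E³} (hQ : Differentiable ℝ Q) (a c : ℝ) (y : E³) :
    fderiv ℝ (fun z => a • Q (c • z)) y = (a * c) • fderiv ℝ Q (c • y) := by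
  -- adapted from the (private) `fderiv_rescale_velocity` of `SteadyNSSolution.lean`
  have hd : DifferentiableAt ℝ (fun z => Q (c • z)) y :=
    (hQ (c • y)).comp y (differentiableAt_id.const_smul c)
  rw [fderiv_fun_const_smul hd, fderiv_comp_smul c, smul_smul]

/-- **Dissipation covariance (zeroth-law normalisation).** For `Q` differentiable and `c > 0`,
`c^{-1/3} ∫_{B_1} |∇(z ↦ c^{2/3} Q(c z))|² = ∫_{B_c} |∇Q|²`: the gradient of the blow-down is
`c^{5/3} ∇Q(c ·)`, `|·|²` picks up `c^{10/3}`, Lebesgue measure `c^{-3}`, and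
`c^{-1/3 + 10/3 - 3} = 1`. [folklore] -/
theorem blowdown_dissipation {Q : E³ → E³} (hQ : Differentiable ℝ Q) {c : ℝ} (hc : 0 < c) :
    c ^ (-(1 / 3 : ℝ)) * (∫ y in Metric.ball (0 : E³) 1,
        frobeniusNormSq (fderiv ℝ (fun z => c ^ (2 / 3 : ℝ) • Q (c • z)) y)) =
      ∫ x in Metric.ball (0 : E³) c, frobeniusNormSq (fderiv ℝ Q x) := by
  have h := Measure.setIntegral_comp_smul_of_pos volume (fun x => frobeniusNormSq (fderiv ℝ Q x))
    (Metric.ball (0 : E³) 1) hc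
  rw [smul_unitBall_of_pos hc, finrank_euclideanSpace_fin, smul_eq_mul] at h
  simp_rw [blowdown_fderiv hQ, frobeniusNormSq_const_smul]
  rw [integral_const_mul, h, ← mul_assoc, blowdown_rpow_dissip hc, ← mul_assoc,
    mul_inv_cancel₀ (pow_ne_zero 3 hc.ne'), one_mul]

/-! ## The stub -/

/-- **TOOLS stub — `stub_blowdownCovariance` (the blow-down covariance dictionary).** For a smooth
steady unforced unit-viscosity Navier–Stokes solution `(Q, Pr)` on `ℝ³`, `λ > 1`, `k : ℕ` and a
DSS cone `V` of degree `-2/3`: (1) `u_k = (λ^k)^{2/3} Q(λ^k ·)`, `p_k = (λ^k)^{4/3} Pr(λ^k ·)` solve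
the unforced steady system with viscosity `(λ^k)^{-1/3}`; (2) the normalised `k`-th shell error of
`Q` against `V` is the fundamental-shell error of `u_k` against `V`; (3)
`(λ^k)^{-1/3} ∫_{B_1} |∇u_k|² = ∫_{B_{λ^k}} |∇Q|²`. [folklore] -/
theorem stub_blowdownCovariance :
    ∀ (Q V : EuclideanSpace ℝ (Fin 3) → EuclideanSpace ℝ (Fin 3)) (Pr : EuclideanSpace ℝ (Fin 3) → ℝ) (lam : ℝ) (k : ℕ), 1 < lam → Literature.Analysis.FluidPDE.IsSteadyClassicalNS 1 0 Q Pr → (∀ x : EuclideanSpace ℝ (Fin 3), x ≠ 0 → V (lam • x) = lam ^ (-(2 / 3 : ℝ)) • V x) → Literature.Analysis.FluidPDE.IsSteadyClassicalNS ((lam ^ k) ^ (-(1 / 3 : ℝ))) 0 (fun y => (lam ^ k) ^ (2 / 3 : ℝ) • Q (lam ^ k • y)) (fun y => (lam ^ k) ^ (4 / 3 : ℝ) * Pr (lam ^ k • y)) ∧ (lam ^ k) ^ (-(5 / 3 : ℝ)) * (∫ x in {x : EuclideanSpace ℝ (Fin 3) | lam ^ k < ‖x‖ ∧ ‖x‖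 < lam ^ (k + 1)}, ‖Q x - V x‖ ^ 2) = ∫ y in {y : EuclideanSpace ℝ (Fin 3) | 1 < ‖y‖ ∧ ‖y‖ < lam}, ‖(lam ^ k) ^ (2 / 3 : ℝ) • Q (lam ^ k • y) - V y‖ ^ 2 ∧ (lam ^ k) ^ (-(1 / 3 : ℝ)) * (∫ y in Metric.ball (0 : EuclideanSpace ℝ (Fin 3)) 1, Literature.Analysis.FluidPDE.frobeniusNormSq (fderiv ℝ (fun z => (lam ^ k) ^ (2 / 3 : ℝ) • Q (lam ^ k • z)) y)) = ∫ x in Metric.ball (0 : EuclideanSpace ℝ (Fin 3)) (lam ^ k), Literature.Analysis.FluidPDE.frobeniusNormSq (fderiv ℝ Q x) := by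
  intro Q V Pr lam k hlam h hV
  have hlam0 : 0 < lam := one_pos.trans hlam
  have hR : 0 < lam ^ k := pow_pos hlam0 k
  refine ⟨?_, blowdown_shell_error hlam0 hV k,
    blowdown_dissipation (h.smooth_velocity.differentiable (by simp)) hR⟩
  have h1 := blowdown_rescale h (lam ^ k) ((lam ^ k) ^ (-(1 / 3 : ℝ)))
  rw [blowdown_rpow_vel hR, blowdown_rpow_pres hR] at h1
  exact h1

end Summit.AnomalousDissipation.AnomalousDissipation.Theorems

end
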